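import Literature.Analysis.Complex.FarFactorReal
import Literature.Analysis.Complex.JensenExpFactor
import HarnessLib

/-!
# Jensen polynomials of real entire functions of order `< 2` with zeros in a sector (proved)

Trunk `Literature/Analysis/Complex`, grouping namespace `Literature.Analysis.Complex.KimLee`.

**Theorem** (`splits_jensenPoly_taylor_of_zeros_mem_sector_two`; Kim–Lee 2021, the argument of the
proof of Thm. 1 and of the Remark after Thm. 3, for order `< 2`). Let `F` be entire with
`‖F z‖ ≤ C exp(‖z‖^ρ)` for some `0 ≤ ρ < 2`, real (`F(z̄) = conj F(z)`), with `F(0) ≠ 0`, and suppose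
every zero of `F` lies in the double sector `S(δ) = {|Im z| ≤ δ |z|}`. Then for `d δ² ≤ 1` the Jensen
polynomial `J^{d,0}` of the Taylor sequence `(F⁽ᵏ⁾(0))_k` — `J(F; d) = Σ_k (d choose k) F⁽ᵏ⁾(0) X^k` —
has only real zeros. (The tree's `Obreschkoff.splits_jensenPoly_taylor_of_zeros_mem_sector` is the
case of order `< 1`, via Hadamard's theorem in genus zero.)

Kim–Lee: "since `f` is of order less than `2`, it can be represented in the form
`f(z) = c z^m e^{bz} ∏ (1 − z/a_j) e^{z/a_j}` … As a consequence, there are real polynomials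
`P₁, P₂, …` such that `Z(P_k) ⊂ Z(f) ∪ ℝ` for all `k`, and `P_k → f` uniformly on compact sets …
the corollary to Theorem 3 implies that `J(P_k; d)` is hyperbolic for every `k`. Therefore `J(f; d)`
is hyperbolic."

## The proof given here (Hadamard-free)

Only the Taylor coefficients of `F` at `0` matter, so approximation near `0` suffices. For
`R = N + 32 → ∞` write `F = P_R · G_R` on `|z| ≤ R` (`P_R` the zero polynomial of `|z| ≤ R/2`, `G_R`
the far factor; `LogDerivFarFactor.lean`). Titchmarsh's lemma and Jensen's bound on the number of
zeros give `|(G_R'/G_R)'| = O(R^{ρ−2})` near `0`, whence `G_R(z) = G_R(0) e^{β_R z} e^{φ_R(z)}` with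
`φ_R → 0` uniformly on `|z| < 2` (`exists_exp_repr_farFactor`, `titchmarshBound_le`, `tendsto_err`).
Thus `H_R(z) = e^{β_R z} P_R(z)/P_R(0) → F(z)/F(0)` uniformly on `|z| < 1`. For a real `F` the zero
data are conjugation-symmetric, so `β_R ∈ ℝ` and `P_R(z)/P_R(0) = ∏ (1 − z/u)^{m(u)}` is a real
polynomial with zeros among the zeros of `F` (`FarFactorReal.lean`); by
`KimLee.splits_jensenPoly_exp_mul` (Obreschkoff's theorem plus the Taylor shift for `e^{βz}`),
`J(H_R; d)` is hyperbolic. Taylor coefficients converge (`tendstoLocallyUniformlyOn_iteratedDeriv`)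
and real-rootedness passes to the limit (`PolyaSchur.splits_of_tendsto_coeff`).

## References

* [KimLee2021] Y.-O. Kim, J. Lee, *A note on the zeros of Jensen polynomials*, arXiv:2105.05386,
  proof of Thm. 1 and the Remark after Thm. 3 (read: pp. 1–2).
* [Farmer2022] D. W. Farmer, Adv. Math. 411 (2022), 108781, §2 (Kim's corollary, which this serves:
  `Literature/Barriers/RiemannHypothesis/JensenPolynomialsKimCorollary.lean`).
-/

noncomputable section

open Complex Filter Metric Set Topology MeromorphicOn Polynomial
open scoped ComplexConjugate

namespace Literature.Analysis.Complex.KimLee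

open Literature.Analysis.Complex.HadamardGenusZero Literature.Analysis.Complex.Obreschkoff
  Literature.Analysis.Complex.PolyaSchur Literature.Analysis.TotalPositivity

/-- Uniform approximation of `F/F(0)` near `0` by `e^{βz} P(z)` with `β` real and `P` a real
polynomial whose zeros are zeros of `F`: the genus-one, Hadamard-free substitute for Kim–Lee's
approximating polynomials. For `F` entire of order `< 2` (`‖F‖ ≤ C e^{‖z‖^ρ}`, `0 ≤ ρ < 2`), real,
`F(0) ≠ 0`: for every `e > 0` there are `β ∈ ℝ` and `q ∈ ℝ[X]` with every complex zero of `q` a zero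
of `F` and `‖e^{βz} q(z) − F(z)/F(0)‖ ≤ e` for `‖z‖ < 1`. [cite: KimLee2021, proof of Theorem 1] -/
theorem exists_exp_mul_polynomial_approx {F : ℂ → ℂ} (hF : Differentiable ℂ F) {ρ C : ℝ}
    (hρ0 : 0 ≤ ρ) (hρ : ρ < 2) (hgr : ∀ z, ‖F z‖ ≤ C * Real.exp (‖z‖ ^ ρ))
    (hreal : ∀ z, F (conj z) = conj (F z)) (h0 : F 0 ≠ 0) {e : ℝ} (he : 0 < e) :
    ∃ (β : ℝ) (q : ℝ[X]), (∀ z : ℂ, aeval z q = 0 → F z = 0) ∧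
      ∀ z ∈ ball (0 : ℂ) 1,
        ‖exp ((β : ℂ) * z) * (q.map (algebraMap ℝ ℂ)).eval z - F z / F 0‖ ≤ e := by
  classical
  -- a bound for `F/F(0)` on the unit disc
  obtain ⟨M₀, hM₀⟩ := (isCompact_closedBall (0 : ℂ) 1).exists_bound_of_continuousOn
    (f := fun z => F z / F 0) (hF.continuous.continuousOn.div_const _)
  have hM₀0 : 0 ≤ M₀ := (norm_nonneg _).trans (hM₀ 0 (mem_closedBall_self zero_le_one))
  -- the error `η(R) = 1024 (K + 2R^ρ)/R² → 0`; choose `R ≥ 32` with `η(R) ≤ min 1 (e/(2M₀+1))`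
  set K : ℝ := Real.log (C / ‖F 0‖) + Real.log (max 1 C / ‖F 0‖) + 1 with hK
  have hη := (tendsto_err hρ K).const_mul 1024
  rw [mul_zero] at hη
  have htarget : 0 < min 1 (e / (2 * M₀ + 1)) := lt_min one_pos (by positivity)
  obtain ⟨R₀, hR₀⟩ := (hη.eventually (gt_mem_nhds htarget)).exists_forall_of_atTop
  set R : ℝ := max R₀ 32 with hRdef
  have hR32 : 32 ≤ R := le_max_right _ _
  have hR0 : 0 < R := by linarith
  have hηR : 1024 * ((K + 2 * R ^ ρ) / R ^ 2) < min 1 (e / (2 * M₀ + 1)) := hR₀ R (le_max_left _ _)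
  -- the factorisation `F = P · G` on `|z| ≤ R`
  obtain ⟨G, hGan, hG0, hFPG⟩ := exists_eq_prod_pow_sub_mul (f := F) (c := 0) (R₂ := R / 2) (R := R)
    (by positivity) (by linarith) (analyticOnNhd_of_entire hF _) h0
  set D := divisor F (closedBall (0 : ℂ) (R / 2)) with hD
  set S := (D.finiteSupport (isCompact_closedBall 0 (R / 2))).toFinset with hS
  -- elementary facts on the zero data
  have h0R : (0 : ℂ) ∈ closedBall (0 : ℂ) R := mem_closedBall_self hR0.le
  have hP0 : ∏ u ∈ S, ((0 : ℂ) - u) ^ (D u).toNat ≠ 0 := fun h => h0 (by rw [hFPG 0 h0R, h, zero_mul])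
  have hG00 : G 0 ≠ 0 := fun h => h0 (by rw [hFPG 0 h0R, h, mul_zero])
  have hS0 : ∀ u ∈ S, u ≠ 0 := by
    intro u hu hu0
    subst hu0
    exact hP0 ((prod_pow_sub_eq_zero_iff hF).2 hu)
  have hSzero : ∀ u ∈ S, F u = 0 := fun u hu => by
    have huR : u ∈ closedBall (0 : ℂ) R :=
      mem_closedBall_zero_iff.2 ((norm_le_of_mem_support F hu).trans (by linarith))
    rw [hFPG u huR, (prod_pow_sub_eq_zero_iff hF).2 hu, zero_mul]
  -- the real polynomial `q` with `q(z) = P(z)/P(0)`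
  obtain ⟨q, hq⟩ := exists_real_lift_prod_pow S (fun u => (D u).toNat)
    (conj_mem_support_iff hF h0 hreal _) (fun u => by simp only [hD, divisor_conj hF h0 hreal])
  have hqeval : ∀ z, (q.map (algebraMap ℝ ℂ)).eval z =
      (∏ u ∈ S, (z - u) ^ (D u).toNat) / ∏ u ∈ S, ((0 : ℂ) - u) ^ (D u).toNat := fun z => by
    rw [hq, eval_prod_one_sub_pow S _ hS0]
  have hqroots : ∀ z : ℂ, aeval z q = 0 → F z = 0 := fun z hz => by
    rw [← eval_map_algebraMap, hq] at hz
    exact hSzero z (mem_of_eval_prod_one_sub_pow_eq_zero hz)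
  -- the real number `β = G'/G(0)`
  set β : ℝ := (logDeriv G 0).re with hβdef
  have hβ : ((β : ℝ) : ℂ) = logDeriv G 0 :=
    Complex.ext (by simp [hβdef]) (by simp [hβdef, im_logDeriv_farFactor_zero hF h0 hreal hR0 hGan hFPG])
  -- Titchmarsh's bound for `G'/G` on `|z| ≤ R/8`
  set ε : ℝ := 16 / R * (Real.log (C * Real.exp (R ^ ρ) / ‖F 0‖) +
    (∑ u ∈ S, (D u : ℝ)) * Real.log 2 + 1) with hε
  have hB : ∀ z ∈ closedBall (0 : ℂ) R, ‖F z‖ ≤ C * Real.exp (R ^ ρ) := fun z hz => by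
    have hC : 0 ≤ C := by
      have h := hgr 0
      by_contra hC; push Not at hC
      have : C * Real.exp (‖(0:ℂ)‖ ^ ρ) < 0 := mul_neg_of_neg_of_pos hC (Real.exp_pos _)
      linarith [norm_nonneg (F 0)]
    rw [mem_closedBall_zero_iff] at hz
    calc ‖F z‖ ≤ C * Real.exp (‖z‖ ^ ρ) := hgr z
      _ ≤ C * Real.exp (R ^ ρ) := by gcongr
  have hεb0 : ∀ z ∈ closedBall (0 : ℂ) (R / 8), F z ≠ 0 → ‖logDeriv G z‖ ≤ ε :=
    fun z hz hFz => norm_logDeriv_farFactor_le_of_ne_zero hF h0 hR0 hB hGan hFPG hz hFz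
  have hcont : ContinuousOn (logDeriv G) (closedBall (0 : ℂ) (R / 8)) := fun z hz => by
    rw [mem_closedBall_zero_iff] at hz
    exact (differentiableAt_logDeriv (hGan z (mem_closedBall_zero_iff.2 (by linarith)))
      (hG0 z (mem_closedBall_zero_iff.2 (by linarith)))).continuousAt.continuousWithinAt
  have hεb : ∀ z ∈ closedBall (0 : ℂ) (R / 8), ‖logDeriv G z‖ ≤ ε :=
    norm_le_of_forall_ne_zero hF h0 hcont hεb0
  -- `G = G(0) e^{βz} e^{φ}` with `φ` small
  obtain ⟨φ, hφ0, -, hGrepr, hφb⟩ := exists_exp_repr_farFactor hR32 hGan hG0 hεb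
  have hεle : ε ≤ 16 / R * (K + 2 * R ^ ρ) := titchmarshBound_le hF h0 hgr hR0
  have hφsmall : ∀ z ∈ ball (0 : ℂ) 2, ‖φ z‖ ≤ 1024 * ((K + 2 * R ^ ρ) / R ^ 2) := fun z hz => by
    have h1 := hφb z hz
    rw [mem_ball_zero_iff] at hz
    have hεnn : 0 ≤ ε := (norm_nonneg _).trans (hεb 0 (mem_closedBall_self (by positivity)))
    calc ‖φ z‖ ≤ 2 * (ε / (R / 16)) * ‖z‖ := h1
      _ ≤ 2 * (ε / (R / 16)) * 2 := by gcongr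
      _ = 64 / R * ε := by field_simp; ring
      _ ≤ 64 / R * (16 / R * (K + 2 * R ^ ρ)) := by gcongr
      _ = 1024 * ((K + 2 * R ^ ρ) / R ^ 2) := by field_simp; ring
  -- conclusion
  refine ⟨β, q, hqroots, fun z hz => ?_⟩
  have hz2 : z ∈ ball (0 : ℂ) 2 := ball_subset_ball (by norm_num) hz
  have hzR : z ∈ closedBall (0 : ℂ) R := by
    rw [mem_ball_zero_iff] at hz; exact mem_closedBall_zero_iff.2 (by linarith)
  have hφz := (hφsmall z hz2).trans_lt hηR
  have hφ1 : ‖φ z‖ ≤ 1 := (hφz.le.trans (min_le_left _ _))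
  -- `H z = (F z / F 0) e^{-φ z}`
  have hH : exp ((β : ℂ) * z) * (q.map (algebraMap ℝ ℂ)).eval z = F z / F 0 * exp (-φ z) := by
    rw [hqeval z, hβ, hFPG z hzR, hFPG 0 h0R, hGrepr z hz2, Complex.exp_neg]
    have he : exp (φ z) ≠ 0 := exp_ne_zero _
    field_simp
  rw [hH]
  have h2 : ‖exp (-φ z) - 1‖ ≤ 2 * ‖φ z‖ := by
    have := Complex.norm_exp_sub_one_le (x := -φ z) (by rwa [norm_neg])
    rwa [norm_neg] at this
  have hFz : ‖F z / F 0‖ ≤ M₀ := hM₀ z (ball_subset_closedBall hz)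
  calc ‖F z / F 0 * exp (-φ z) - F z / F 0‖ = ‖F z / F 0‖ * ‖exp (-φ z) - 1‖ := by
        rw [← norm_mul, mul_sub, mul_one]
    _ ≤ M₀ * (2 * ‖φ z‖) := by gcongr
    _ ≤ M₀ * (2 * (e / (2 * M₀ + 1))) := by
        gcongr
        exact hφz.le.trans (min_le_right _ _)
    _ ≤ e := by
        rw [show M₀ * (2 * (e / (2 * M₀ + 1))) = e * (2 * M₀ / (2 * M₀ + 1)) by ring]
        have : 2 * M₀ / (2 * M₀ + 1) ≤ 1 := by
          rw [div_le_one (by positivity)]; linarith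
        calc e * (2 * M₀ / (2 * M₀ + 1)) ≤ e * 1 := by gcongr
          _ = e := mul_one e

/-- **Jensen polynomials of a real entire function of order `< 2` with zeros in `S(δ)` are hyperbolic
up to degree `δ⁻²`** (Kim–Lee 2021, proof of Thm. 1 / Remark after Thm. 3, for genus one). If `F` is
entire with `‖F z‖ ≤ C exp(‖z‖^ρ)`, `0 ≤ ρ < 2`, real (`F(z̄) = conj F(z)`), `F 0 ≠ 0`, and every zero
of `F` lies in `S(δ) = {|Im z| ≤ δ|z|}`, then for `d δ² ≤ 1` the Jensen polynomial `J^{d,0}` of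
`(Re F⁽ᵏ⁾(0))_k` has only real zeros. [cite: KimLee2021, Theorem 1 (proof) and Remark after Theorem 3] -/
theorem splits_jensenPoly_taylor_of_zeros_mem_sector_two {F : ℂ → ℂ} (hF : Differentiable ℂ F)
    {ρ C : ℝ} (hρ0 : 0 ≤ ρ) (hρ : ρ < 2) (hgr : ∀ z, ‖F z‖ ≤ C * Real.exp (‖z‖ ^ ρ))
    (hreal : ∀ z, F (conj z) = conj (F z)) (h0 : F 0 ≠ 0) {δ : ℝ}
    (hzero : ∀ z : ℂ, F z = 0 → z ∈ sector δ) {d : ℕ} (hd : (d : ℝ) * δ ^ 2 ≤ 1) :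
    (Literature.NumberTheory.LFunctions.jensenPoly (fun k => (iteratedDeriv k F 0).re) d 0).Splits := by
  classical
  -- approximants `H N`, `N = 1, 2, …`, with error `≤ 1/(N+1)` on the unit disc
  have happ := fun N : ℕ => exists_exp_mul_polynomial_approx hF hρ0 hρ hgr hreal h0
    (e := 1 / ((N : ℝ) + 1)) (by positivity)
  choose β q hq happrox using happ
  set H : ℕ → ℂ → ℂ := fun N z => exp ((β N : ℂ) * z) * ((q N).map (algebraMap ℝ ℂ)).eval z with hH
  -- their Jensen polynomials are hyperbolic (Obreschkoff + Taylor shift)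
  have hroots : ∀ N, ∀ z : ℂ, aeval z (q N) = 0 → z ∈ sector δ := fun N z hz => hzero z (hq N z hz)
  have hsplit : ∀ N, (Literature.NumberTheory.LFunctions.jensenPoly
      (fun k => (iteratedDeriv k (H N) 0).re) d 0).Splits :=
    fun N => splits_jensenPoly_exp_mul (hroots N) hd (β N)
  -- uniform convergence on the unit disc
  have hunif : TendstoUniformlyOn H (fun z => F z / F 0) atTop (ball (0 : ℂ) 1) := by
    refine Metric.tendstoUniformlyOn_iff.2 fun e he => ?_
    obtain ⟨N₀, hN₀⟩ := exists_nat_one_div_lt he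
    filter_upwards [eventually_ge_atTop N₀] with N hN z hz
    rw [dist_comm, dist_eq_norm]
    calc ‖H N z - F z / F 0‖ ≤ 1 / ((N : ℝ) + 1) := happrox N z hz
      _ ≤ 1 / ((N₀ : ℝ) + 1) := by gcongr
      _ < e := hN₀
  have hloc : TendstoLocallyUniformlyOn H (fun z => F z / F 0) atTop (ball (0 : ℂ) 1) :=
    hunif.tendstoLocallyUniformlyOn
  have hHd : ∀ N, Differentiable ℂ (H N) := fun N => by
    simp only [hH]
    exact (differentiable_exp.comp ((differentiable_const _).mul differentiable_id)).mul
      (Polynomial.differentiable _)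
  -- `F 0` is real
  have hF0 : (((F 0).re : ℝ) : ℂ) = F 0 := by
    have h := hreal 0
    rw [map_zero] at h
    exact conj_eq_iff_re.1 h.symm
  have hc0 : (F 0).re ≠ 0 := fun h => h0 (by rw [← hF0, h, ofReal_zero])
  -- Taylor coefficients converge
  have hcoef : ∀ m, Tendsto (fun N => (iteratedDeriv m (H N) 0).re) atTop
      (𝓝 ((iteratedDeriv m F 0).re / (F 0).re)) := fun m => by
    have h1 := ((tendstoLocallyUniformlyOn_iteratedDeriv isOpen_ball hHd hloc m).tendsto_at
      (mem_ball_self one_pos))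
    have h2 : iteratedDeriv m (fun z => F z / F 0) 0 = iteratedDeriv m F 0 / F 0 :=
      iteratedDeriv_div_const _ _
    rw [h2] at h1
    have h3 := (continuous_re.tendsto _).comp h1
    rwa [← hF0, div_ofReal_re] at h3
  -- pass to the limit for the sequence `γₘ / F(0)`, then rescale
  have key : (Literature.NumberTheory.LFunctions.jensenPoly
      (fun m => (iteratedDeriv m F 0).re / (F 0).re) d 0).Splits := by
    refine splits_of_tendsto_coeff (l := atTop)
      (P := fun N => Literature.NumberTheory.LFunctions.jensenPoly
        (fun k => (iteratedDeriv k (H N) 0).re) d 0) (N := d)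
      (fun N => natDegree_jensenPoly_le _ _ _) (natDegree_jensenPoly_le _ _ _) (fun j => ?_)
      (Eventually.of_forall hsplit)
    by_cases hj : j ≤ d
    · simp only [coeff_jensenPoly, if_pos hj, zero_add]
      exact (hcoef j).const_mul _
    · simp only [coeff_jensenPoly, if_neg hj]
      exact tendsto_const_nhds
  have hresc : (fun m => (iteratedDeriv m F 0).re) =
      fun m => (F 0).re * ((iteratedDeriv m F 0).re / (F 0).re) := by
    funext m; field_simp
  rw [hresc, jensenPoly_const_mul]
  exact key.C_mul _

end Literature.Analysis.Complex.KimLee
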